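import Summits.AtomisticToContinuum.HydrodynamicLimit.Theorems.OneFlightGossipEngineCollisionActivityTailsAbnormalActivityHot
import Summits.AtomisticToContinuum.HydrodynamicLimit.Theorems.OneFlightGossipEngineCollisionActivityTailsEnvelopePlumbing
import Summits.AtomisticToContinuum.HydrodynamicLimit.Theorems.StiffCollisionalRelaxationAssemblyVelocities
import Summits.AtomisticToContinuum.HydrodynamicLimit.Theorems.OneFlightGossipEngineCollisionActivityTailsCrowdedActivityMeasurable
import Summits.AtomisticToContinuum.HydrodynamicLimit.Theorems.OneFlightGossipEngineCollisionActivityTailsEndpointTails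
import Literature.MathematicalPhysics.KineticTheory.HardSphereEulerProofs
import Literature.Analysis.FluidPDE.HardSphereTorusMeasure
import HarnessLib

/-!
# `CollisionActivityTails` (stmt-AtomisticToContinuum-13734), line `plaque-thinning-count-ld`, stub 5, TAGGED half — file 1/6:
the statics of cluster events under a label-set law envelope

Helper file (`--supports stmt-AtomisticToContinuum-13734`) of the crux
`Summit.AtomisticToContinuum.HydrodynamicLimit.Theses.OneFlightGossipEngine.CollisionActivityTails`, line `plaque-thinning-count-ld`,
stub 5 (abnormal activity), TAGGED half `stub_taggedFromLabelEnvelope : LabelEnvelopeFromEnvelope → TaggedFromEnvelope`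
(file `…AbnormalActivityTagged`): under the true local Gibbs law the tagged cold window activity (collisions of particles sitting in an
over-dense or over-heated ball at some scale `≥ K`) is small in mean, from a label-set law envelope of the laws at the times of the
window. Vocabulary: `Tagged`, `tagAct`, `TaggedSmallOn`, `TaggedFromEnvelope`, `imp_le_relSpeed` of `…AbnormalActivity(Hot)` (w-abnormal),
`LabelLawEnvelope`, `LabelEnvelopeOn`, `LabelEnvelopeFromEnvelope` of `…EnvelopePlumbing` (lead), `windowEvent`, `pairTubeSet` of
`…AbnormalActivityStatics`.

This file: the one-point Gaussian weights `gaussWeight`, `gaussV` (`∫ e^{-β|v|²/2} = (2π/β)^{3/2}`, `lintegral_gaussV`), the Haar volume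
of a minimal-image ball `volume_tdist_le` (`≤ (4π/3)R³ = ballVol R`) and the one-label factor `lintegral_nearInd_mul_le`, the tilt
`expW = e^{λ|v|²}`, `λ = β/4`, and the two-point flux constant `fluxJ β = ∫∫ |v-v'|² e^{λ|v|²}e^{λ|v'|²} e^{-β(|v|²+|v'|²)/2} < ∞`; the
total-mass consequence `1 ≤ C (2π/β)^{3/2}` of a label-set envelope of a probability law (`one_le_envelopeConst`); and the KEY
CLUSTER BOUND `lintegral_pair_mul_prod_le` (registered helper sub-goal `stub_taggedClusterBound`): for labels `k ≠ l`, a finset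
`A ∌ k, l`, a pair functional `T(w_k, w_l)` and one-particle factors `φ(w_k, w_j)`, `j ∈ A`, of Gaussian-weighted integral `≤ Φb`
uniformly in `w_k`, `∫ T Π_{j∈A} φ dμ ≤ C² (C Φb)^{|A|} ∫∫ T e^{-β|v|²/2} e^{-β|v'|²/2}` (the envelope on the `|A|+2` labels; Tonelli
over the pi type `measurePreserving_piFinSuccAbove`, `lintegral_fin_nat_prod_eq_prod`).

References: C. Cercignani, R. Illner, M. Pulvirenti, *The Mathematical Theory of Dilute Gases* (1994), §4.3, App. 4.A (collision
cylinders, collision sums along the hard-sphere flow); I. Gallagher, L. Saint-Raymond, B. Texier, *From Newton to Boltzmann* (2013),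
Ch. 4. Elementary measure theory and bookkeeping; recorded here.
-/

noncomputable section

open MeasureTheory Set Filter Topology
open scoped ENNReal

namespace Summit.AtomisticToContinuum.HydrodynamicLimit.Theorems.CollisionActivityTailsAbnormalActivityTagged

open Literature.MathematicalPhysics.KineticTheory Literature.Analysis.FluidPDE
open Summit.AtomisticToContinuum.HydrodynamicLimit.Theorems.CollisionActivityTailsActivityDomination
  (Flow Cfg window act tdist nearCount collisionPairSum_nonneg window_pos)
open Summit.AtomisticToContinuum.HydrodynamicLimit.Theorems.CollisionActivityTailsAbnormalActivityStatics
open Summit.AtomisticToContinuum.HydrodynamicLimit.Theorems.CollisionActivityTailsCrowdedActivityMeasurable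
  (measurable_tdist_config natCast_nearCount)
open Summit.AtomisticToContinuum.HydrodynamicLimit.Theorems.CollisionActivityTailsEndpointTails (ae_mem_good_localGibbsLaw)
-- the tagging vocabulary and the two statements of the tagged half (w-abnormal's reduction file, landed):
open Summit.AtomisticToContinuum.HydrodynamicLimit.Theorems.CollisionActivityTailsAbnormalActivity
  (rec imp relSpeed scaleRadius ballKinetic Tagged tagAct TaggedSmallOn TaggedFromEnvelope imp_le_relSpeed
    hsDiameter_sq_mul_window eventually_window_lt)
-- σ-finiteness of the phase spaces (named instances, landed):
open Summit.AtomisticToContinuum.HydrodynamicLimit.Theorems.MacroBookkeeping (sigmaFinite_volume_phase sigmaFinite_volume_config)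
-- the label-set envelope vocabulary (the lead's plumbing, landed with `stub_labelEnvelopeOn`):
open Summit.AtomisticToContinuum.HydrodynamicLimit.Theorems.CollisionActivityTailsEnvelopePlumbing
  (gaussTupleWeight LabelLawEnvelope LabelEnvelopeOn LabelEnvelopeFromEnvelope)

/-! ## §1 Statics under a label-set law envelope -/

section Statics

variable {N : ℕ}

/-- The one-point Gaussian weight `e^{-β |v|²/2}` of a phase point, in `ℝ≥0∞`. -/
def gaussWeight (β : ℝ) (p : T3 × V3) : ℝ≥0∞ :=
  ENNReal.ofReal (Real.exp (-(β * (2⁻¹ * ‖p.2‖ ^ 2))))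

/-- The one-point Gaussian weight is measurable. -/
theorem measurable_gaussWeight (β : ℝ) : Measurable (gaussWeight β) := by
  unfold gaussWeight; fun_prop

/-- The Gaussian velocity weight `e^{-β|v|²/2}` in `ℝ≥0∞` (`gaussWeight β p = gaussV β p.2`). -/
def gaussV (β : ℝ) (v : V3) : ℝ≥0∞ := ENNReal.ofReal (Real.exp (-(β * (2⁻¹ * ‖v‖ ^ 2))))

/-- `gaussV` is measurable. -/
theorem measurable_gaussV (β : ℝ) : Measurable (gaussV β) := by unfold gaussV; fun_prop

/-- `gaussWeight β p = gaussV β p.2`. -/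
theorem gaussWeight_eq (β : ℝ) (p : T3 × V3) : gaussWeight β p = gaussV β p.2 := rfl

/-- **The Gaussian integral** `∫ e^{-β|v|²/2} dv = (2π/β)^{3/2}` on `ℝ³` (Mathlib's `integral_rexp_neg_mul_sq_norm`, moved to
`ℝ≥0∞`). -/
theorem lintegral_gaussV {β : ℝ} (hβ : 0 < β) : ∫⁻ v, gaussV β v = ENNReal.ofReal ((2 * Real.pi / β) ^ (3 / 2 : ℝ)) := by
  have hb : 0 < β / 2 := by positivity
  have hint : Integrable (fun v : V3 => Real.exp (-(β / 2) * ‖v‖ ^ 2)) := by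
    refine Integrable.of_integral_ne_zero ?_
    rw [GaussianFourier.integral_rexp_neg_mul_sq_norm hb]
    positivity
  have h1 : ∫⁻ v, gaussV β v = ENNReal.ofReal (∫ v : V3, Real.exp (-(β / 2) * ‖v‖ ^ 2)) := by
    rw [ofReal_integral_eq_lintegral_ofReal hint (Eventually.of_forall fun v => Real.exp_nonneg _)]
    refine lintegral_congr fun v => ?_
    unfold gaussV
    congr 2; ring
  rw [h1, GaussianFourier.integral_rexp_neg_mul_sq_norm hb, finrank_euclideanSpace_fin]
  congr 2
  field_simp

/-- The Gaussian integral is finite. -/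
theorem lintegral_gaussV_lt_top {β : ℝ} (hβ : 0 < β) : ∫⁻ v, gaussV β v < ⊤ := by
  rw [lintegral_gaussV hβ]; exact ENNReal.ofReal_lt_top

/-- Lebesgue volume of a ball of radius `R` in `ℝ³`, `(4π/3) R³`, in `ℝ≥0∞` (zero for `R ≤ 0`). -/
def ballVol (R : ℝ) : ℝ≥0∞ := ENNReal.ofReal R ^ 3 * ENNReal.ofReal (Real.pi * 4 / 3)

/-- **Haar volume of a minimal-image ball**: `vol {x ∈ 𝕋³ : |x - c| ≤ R} ≤ (4π/3) R³` (the minimal-image set is the Lebesgue volume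
of `closedBall 0 R ∩ (-1/2,1/2]³`, `Torus.volume_reprSym_sub_mem`). -/
theorem volume_tdist_le (c : T3) (R : ℝ) : volume {x : T3 | tdist x c ≤ R} ≤ ballVol R := by
  have h : {x : T3 | tdist x c ≤ R} = {x : T3 | Torus.reprSym (x - c) ∈ Metric.closedBall (0 : V3) R} := by
    ext x
    simp only [mem_setOf_eq, Metric.mem_closedBall, dist_zero_right]
    rfl
  rw [h, Torus.volume_reprSym_sub_mem c Metric.isClosed_closedBall.measurableSet, ballVol,
    ← EuclideanSpace.volume_closedBall_fin_three (0 : V3) R]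
  exact measure_mono inter_subset_left

/-- The indicator `𝟙{|x - c| ≤ R}` of the minimal-image ball around `c`, in `ℝ≥0∞`. -/
def nearInd (R : ℝ) (c x : T3) : ℝ≥0∞ := if tdist x c ≤ R then 1 else 0

/-- `nearInd ≤ 1`. -/
theorem nearInd_le_one (R : ℝ) (c x : T3) : nearInd R c x ≤ 1 := by
  unfold nearInd; split_ifs <;> simp

/-- The ball indicator is jointly measurable in (centre, point). -/
theorem measurable_nearInd (R : ℝ) : Measurable fun cx : T3 × T3 => nearInd R cx.1 cx.2 := by
  unfold nearInd tdist
  have hm : Measurable fun cx : T3 × T3 => ‖(Torus.geometry (Fin 3)).sepVec cx.2 cx.1‖ :=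
    (Torus.measurable_geometry_sepVec.comp (measurable_snd.prodMk measurable_fst)).norm
  exact Measurable.ite (measurableSet_le hm measurable_const) measurable_const measurable_const

/-- **One extra label costs `vol(ball) × (velocity integral)`**: `∫ 𝟙{|x - c| ≤ R} ψ(v) d(x, v) ≤ (4π/3) R³ ∫ ψ`. -/
theorem lintegral_nearInd_mul_le (R : ℝ) (c : T3) {ψ : V3 → ℝ≥0∞} (hψ : Measurable ψ) :
    ∫⁻ q : T3 × V3, nearInd R c q.1 * ψ q.2 ≤ ballVol R * ∫⁻ v, ψ v := by
  have hm : Measurable fun x : T3 => nearInd R c x :=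
    (measurable_nearInd R).comp (f := fun x : T3 => (c, x)) (measurable_const.prodMk measurable_id)
  rw [show (volume : Measure (T3 × V3)) = (volume : Measure T3).prod volume from rfl,
    lintegral_prod_mul hm.aemeasurable hψ.aemeasurable]
  gcongr
  have hind : (fun x : T3 => nearInd R c x) = {x : T3 | tdist x c ≤ R}.indicator 1 := by
    funext x
    unfold nearInd
    by_cases hx : tdist x c ≤ R
    · rw [if_pos hx, indicator_of_mem (show x ∈ {x : T3 | tdist x c ≤ R} from hx), Pi.one_apply]
    · rw [if_neg hx, indicator_of_notMem (show x ∉ {x : T3 | tdist x c ≤ R} from hx)]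
  have hms : MeasurableSet {x : T3 | tdist x c ≤ R} := by
    have hm' : Measurable fun x : T3 => tdist x c := by
      unfold tdist
      exact (Torus.measurable_geometry_sepVec.comp (measurable_id.prodMk measurable_const)).norm
    exact measurableSet_le hm' measurable_const
  rw [hind, lintegral_indicator_one hms]
  exact volume_tdist_le c R

/-- The exponential velocity weight `e^{λ|v|²}`, `λ = β/4`, of the kinetic tag and of the speed cap, in `ℝ≥0∞`. -/
def expW (β : ℝ) (v : V3) : ℝ≥0∞ := ENNReal.ofReal (Real.exp (β / 4 * ‖v‖ ^ 2))

/-- `expW` is measurable. -/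
theorem measurable_expW (β : ℝ) : Measurable (expW β) := by unfold expW; fun_prop

/-- `1 ≤ expW` for `β ≥ 0`. -/
theorem one_le_expW {β : ℝ} (hβ : 0 ≤ β) (v : V3) : 1 ≤ expW β v :=
  ENNReal.one_le_ofReal.2 (Real.one_le_exp (by positivity))

/-- `(e^{λ|v|²} - 1) e^{-β|v|²/2} ≤ e^{λ|v|²} e^{-β|v|²/2} = e^{-β|v|²/4}`: the tilted weight is the Gaussian at `β/2`. -/
theorem expW_mul_gaussV (β : ℝ) (v : V3) : expW β v * gaussV β v = gaussV (β / 2) v := by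
  unfold expW gaussV
  rw [← ENNReal.ofReal_mul (Real.exp_nonneg _), ← Real.exp_add]
  congr 2; ring

/-- **THE TWO-POINT FLUX CONSTANT** of the tagged half: `J(β) = ∫∫ |v - v'|² e^{λ|v|²} e^{λ|v'|²} e^{-β(|v|²+|v'|²)/2} dv dv'`,
`λ = β/4` (`= ∫∫ |v-v'|² e^{-β(|v|²+|v'|²)/4}`, finite). -/
def fluxJ (β : ℝ) : ℝ≥0∞ :=
  ∫⁻ vv : V3 × V3, ENNReal.ofReal (‖vv.1 - vv.2‖ ^ 2) * (expW β vv.1 * expW β vv.2) * gaussV β vv.1 * gaussV β vv.2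

/-- The flux constant is finite (`lintegral_hotFluxDominant_lt_top` at `β/2`). -/
theorem fluxJ_lt_top {β : ℝ} (hβ : 0 < β) : fluxJ β < ⊤ := by
  refine lt_of_le_of_lt (le_of_eq ?_) (lintegral_hotFluxDominant_lt_top (β := β / 2) (by positivity))
  refine lintegral_congr fun vv => ?_
  rw [show ENNReal.ofReal (‖vv.1 - vv.2‖ ^ 2) * (expW β vv.1 * expW β vv.2) * gaussV β vv.1 * gaussV β vv.2 =
      ENNReal.ofReal (‖vv.1 - vv.2‖ ^ 2) * ((expW β vv.1 * gaussV β vv.1) * (expW β vv.2 * gaussV β vv.2)) by ring,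
    expW_mul_gaussV, expW_mul_gaussV, gaussV, gaussV, ← ENNReal.ofReal_mul (Real.exp_nonneg _), ← Real.exp_add,
    ← ENNReal.ofReal_mul (sq_nonneg _)]
  congr 2; ring

/-- The tuple weight is the product of the one-point weights. -/
theorem gaussTupleWeight_eq_prod (β : ℝ) {m : ℕ} (q : Fin m → T3 × V3) :
    gaussTupleWeight β q = ∏ a : Fin m, gaussWeight β (q a) := by
  unfold gaussTupleWeight gaussWeight
  rw [← ENNReal.ofReal_prod_of_nonneg fun a _ => Real.exp_nonneg _, ← Real.exp_sum]
  congr 1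
  rw [Finset.mul_sum, Finset.mul_sum, ← Finset.sum_neg_distrib]

/-- **Total mass forces `1 ≤ C (2π/β)^{3/2}`**: a label-set envelope of a PROBABILITY law (one label, `G ≡ 1`) gives
`1 = μ(univ) ≤ C ∫ e^{-β|v|²/2} dv = C (2π/β)^{3/2}` (Haar measure of `𝕋³` is `1`). -/
theorem one_le_envelopeConst {μ : Measure (Cfg N)} [IsProbabilityMeasure μ] {C β : ℝ} (hC : 0 ≤ C) (hβ : 0 < β)
    (hμ : LabelLawEnvelope μ C β) : 1 ≤ C * (2 * Real.pi / β) ^ (3 / 2 : ℝ) := by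
  -- one label
  let ι : Fin 1 ↪ Fin (N + 1) := ⟨fun _ => 0, fun a b _ => Subsingleton.elim a b⟩
  have h := hμ 1 ι (fun _ => 1) measurable_const
  simp only [lintegral_const, measure_univ, mul_one, one_mul, pow_one] at h
  -- the Gaussian integral over `Fin 1 → T3 × V3`
  have hgauss : ∫⁻ q : Fin 1 → T3 × V3, gaussTupleWeight β q = ENNReal.ofReal ((2 * Real.pi / β) ^ (3 / 2 : ℝ)) := by
    have h1 : ∫⁻ q : Fin 1 → T3 × V3, gaussTupleWeight β q = ∫⁻ p : T3 × V3, gaussWeight β p := by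
      rw [← (volume_preserving_funUnique (Fin 1) (T3 × V3)).lintegral_comp_emb
        (MeasurableEquiv.measurableEmbedding _)]
      refine lintegral_congr fun q => ?_
      rw [gaussTupleWeight_eq_prod, Fin.prod_univ_one]
      rfl
    have h2 : ∫⁻ p : T3 × V3, gaussWeight β p = ∫⁻ v : V3, gaussV β v := by
      rw [show (volume : Measure (T3 × V3)) = (volume : Measure T3).prod (volume : Measure V3) from rfl,
        lintegral_prod _ ((measurable_gaussWeight β).aemeasurable)]
      simp only [gaussWeight_eq, lintegral_const, measure_univ, mul_one]
    rw [h1, h2, lintegral_gaussV hβ]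
  rw [hgauss, ← ENNReal.ofReal_mul hC, ENNReal.one_le_ofReal] at h
  exact h

/-- Tonelli over the pi type with the first coordinate split off (`measurePreserving_piFinSuccAbove` at `0`):
`∫ f (q 0) (q ∘ succ) dq = ∫ x, ∫ q', f x q'` on `Fin (n+1) → 𝕋³ × ℝ³`. -/
theorem lintegral_pi_cons {n : ℕ} {f : (T3 × V3) → (Fin n → T3 × V3) → ℝ≥0∞}
    (hf : Measurable fun p : (T3 × V3) × (Fin n → T3 × V3) => f p.1 p.2) :
    ∫⁻ q : Fin (n + 1) → T3 × V3, f (q 0) (fun i : Fin n => q i.succ) =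
      ∫⁻ x : T3 × V3, ∫⁻ q' : Fin n → T3 × V3, f x q' := by
  have hmp := (@measurePreserving_piFinSuccAbove n (fun _ => T3 × V3) (fun _ => inferInstance)
    (fun _ : Fin (n + 1) => (volume : Measure (T3 × V3))) (fun _ => sigmaFinite_volume_phase) 0).symm
  haveI := sigmaFinite_volume_config n
  have hcons : ∀ p : (T3 × V3) × (Fin n → T3 × V3),
      (MeasurableEquiv.piFinSuccAbove (fun _ : Fin (n + 1) => T3 × V3) 0).symm p = Fin.cons p.1 p.2 := by
    intro p
    rw [MeasurableEquiv.piFinSuccAbove_symm_apply]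
    simp [Fin.insertNthEquiv]
  rw [volume_pi, ← hmp.lintegral_comp_emb (MeasurableEquiv.measurableEmbedding _)]
  simp_rw [hcons, Fin.cons_zero, Fin.cons_succ]
  rw [← volume_pi]
  exact lintegral_prod _ hf.aemeasurable

/-- Tonelli for a product over `Fin n` of one-coordinate factors on `Fin n → 𝕋³ × ℝ³` (volume). -/
theorem lintegral_pi_prod {n : ℕ} {F : Fin n → (T3 × V3) → ℝ≥0∞} (hF : ∀ i, Measurable (F i)) :
    ∫⁻ q : Fin n → T3 × V3, ∏ i, F i (q i) = ∏ i, ∫⁻ p, F i p := by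
  rw [volume_pi]
  exact @lintegral_fin_nat_prod_eq_prod n (fun _ => T3 × V3) (fun _ => inferInstance)
    (fun _ : Fin n => (volume : Measure (T3 × V3))) (fun _ => sigmaFinite_volume_phase) F hF

/-- The labelling of a cluster: `0 ↦ k`, `1 ↦ l`, `a + 2 ↦` the `a`-th element of `A` (increasing); injective when `k ≠ l` and
`k, l ∉ A`. -/
theorem clusterLabel_injective {k l : Fin (N + 1)} (hkl : k ≠ l) {A : Finset (Fin (N + 1))} (hAk : k ∉ A) (hAl : l ∉ A) :
    Function.Injective (Fin.cons k (Fin.cons l (fun a : Fin A.card => (A.orderEmbOfFin rfl a : Fin (N + 1)))) :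
      Fin (A.card + 2) → Fin (N + 1)) := by
  rw [Fin.cons_injective_iff, Fin.cons_injective_iff]
  refine ⟨?_, ?_, (A.orderEmbOfFin rfl).injective⟩
  · rintro ⟨i, hi⟩
    refine Fin.cases ?_ (fun a => ?_) i hi
    · simp only [Fin.cons_zero]; exact fun h => hkl h.symm
    · simp only [Fin.cons_succ]; exact fun h => hAk (h ▸ A.orderEmbOfFin_mem rfl a)
  · rintro ⟨a, ha⟩
    exact hAl (ha ▸ A.orderEmbOfFin_mem rfl a)

/-- A product over `A` is the product over `Fin |A|` through the increasing enumeration. -/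
theorem prod_orderEmbOfFin {M : Type*} [CommMonoid M] (A : Finset (Fin (N + 1))) (f : Fin (N + 1) → M) :
    ∏ a : Fin A.card, f (A.orderEmbOfFin rfl a) = ∏ j ∈ A, f j := by
  rw [← Finset.prod_coe_sort A f]
  exact Fintype.prod_equiv (A.orderIsoOfFin rfl).toEquiv _ _ fun a => rfl

/-- **KEY CLUSTER BOUND under a label-set law envelope.** For labels `k ≠ l`, a finset `A ∌ k, l` of further labels, a measurable
pair functional `T` and measurable one-particle factors `φ (w_k, w_j)` whose Gaussian-weighted integral in the second variable is
`≤ Φb` uniformly in the first,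
`∫ T(w_k, w_l) Π_{j ∈ A} φ(w_k, w_j) dμ ≤ C² (C Φb)^{|A|} ∫∫ T(p, p') e^{-β|v|²/2} e^{-β|v'|²/2} dp dp'`
(the envelope on the `|A| + 2` labels `k, l, A`; Tonelli over the extra labels one product at a time). -/
theorem lintegral_pair_mul_prod_le {μ : Measure (Cfg N)} {C β : ℝ} (hC : 0 ≤ C) (hμ : LabelLawEnvelope μ C β)
    {k l : Fin (N + 1)} (hkl : k ≠ l) {A : Finset (Fin (N + 1))} (hAk : k ∉ A) (hAl : l ∉ A)
    {T φ : T3 × V3 → T3 × V3 → ℝ≥0∞} (hT : Measurable fun pp : (T3 × V3) × (T3 × V3) => T pp.1 pp.2)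
    (hφ : Measurable fun pp : (T3 × V3) × (T3 × V3) => φ pp.1 pp.2)
    {Φb : ℝ≥0∞} (hΦb : ∀ p, ∫⁻ q, φ p q * gaussWeight β q ≤ Φb) :
    ∫⁻ w, T (w k) (w l) * ∏ j ∈ A, φ (w k) (w j) ∂μ ≤
      ENNReal.ofReal (C ^ 2) * (ENNReal.ofReal C * Φb) ^ A.card *
        ∫⁻ pp : (T3 × V3) × (T3 × V3), T pp.1 pp.2 * gaussWeight β pp.1 * gaussWeight β pp.2 := by
  set b := A.card with hb
  -- the labelling and the cluster functional
  let ι : Fin (b + 2) ↪ Fin (N + 1) :=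
    ⟨Fin.cons k (Fin.cons l (fun a : Fin b => (A.orderEmbOfFin rfl a : Fin (N + 1)))), clusterLabel_injective hkl hAk hAl⟩
  set G : (Fin (b + 2) → T3 × V3) → ℝ≥0∞ := fun q => T (q 0) (q 1) * ∏ a : Fin b, φ (q 0) (q a.succ.succ) with hG
  have hGm : Measurable G := by
    have h1 : Measurable fun q : Fin (b + 2) → T3 × V3 => T (q 0) (q 1) :=
      hT.comp (f := fun q : Fin (b + 2) → T3 × V3 => (q 0, q 1)) ((measurable_pi_apply 0).prodMk (measurable_pi_apply 1))
    have h2 : ∀ a : Fin b, Measurable fun q : Fin (b + 2) → T3 × V3 => φ (q 0) (q a.succ.succ) := fun a =>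
      hφ.comp (f := fun q : Fin (b + 2) → T3 × V3 => (q 0, q a.succ.succ))
        ((measurable_pi_apply 0).prodMk (measurable_pi_apply _))
    exact h1.mul (Finset.measurable_prod _ fun a _ => h2 a)
  have hGι : ∀ w : Cfg N, G (fun a => w (ι a)) = T (w k) (w l) * ∏ j ∈ A, φ (w k) (w j) := by
    intro w
    simp only [hG]
    congr 1
    exact prod_orderEmbOfFin A fun j => φ (w k) (w j)
  have h := hμ (b + 2) ι G hGm
  simp_rw [hGι] at h
  refine h.trans ?_
  -- the Gaussian integral of the cluster functional, first coordinate split off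
  set g := gaussWeight β with hg
  have hgm : Measurable g := measurable_gaussWeight β
  set f : (T3 × V3) → (Fin (b + 1) → T3 × V3) → ℝ≥0∞ := fun x q' =>
    (T x (q' 0) * g x * g (q' 0)) * ∏ a : Fin b, (φ x (q' a.succ) * g (q' a.succ)) with hf
  have hsplit : ∀ q : Fin (b + 2) → T3 × V3, G q * gaussTupleWeight β q = f (q 0) (fun i : Fin (b + 1) => q i.succ) := by
    intro q
    simp only [hf, hG]
    rw [gaussTupleWeight_eq_prod, Fin.prod_univ_succ, Fin.prod_univ_succ, Finset.prod_mul_distrib]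
    simp only [Fin.succ_zero_eq_one, hg]
    ring
  simp_rw [hsplit]
  have hfm : Measurable fun p : (T3 × V3) × (Fin (b + 1) → T3 × V3) => f p.1 p.2 := by
    refine Measurable.mul ?_ ?_
    · exact ((hT.comp (f := fun p : (T3 × V3) × (Fin (b + 1) → T3 × V3) => (p.1, p.2 0))
        (measurable_fst.prodMk ((measurable_pi_apply 0).comp measurable_snd))).mul
        (hgm.comp measurable_fst)).mul (hgm.comp ((measurable_pi_apply 0).comp measurable_snd))
    · exact Finset.measurable_prod _ fun a _ =>
        (hφ.comp (f := fun p : (T3 × V3) × (Fin (b + 1) → T3 × V3) => (p.1, p.2 a.succ))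
          (measurable_fst.prodMk ((measurable_pi_apply _).comp measurable_snd))).mul
          (hgm.comp ((measurable_pi_apply _).comp measurable_snd))
  rw [lintegral_pi_cons hfm]
  -- the inner integral is a product of one-coordinate integrals
  have hinner : ∀ x : T3 × V3, ∫⁻ q' : Fin (b + 1) → T3 × V3, f x q' ≤ (∫⁻ p, T x p * g x * g p) * Φb ^ b := by
    intro x
    set F : Fin (b + 1) → (T3 × V3) → ℝ≥0∞ := Fin.cons (fun p => T x p * g x * g p) (fun _ p => φ x p * g p) with hF
    have hFm : ∀ i, Measurable (F i) := by
      refine Fin.cases ?_ (fun a => ?_)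
      · simp only [hF, Fin.cons_zero]
        exact ((hT.comp (f := fun p : T3 × V3 => (x, p)) (measurable_const.prodMk measurable_id)).mul
          measurable_const).mul hgm
      · simp only [hF, Fin.cons_succ]
        exact (hφ.comp (f := fun p : T3 × V3 => (x, p)) (measurable_const.prodMk measurable_id)).mul hgm
    have hprod : ∀ q' : Fin (b + 1) → T3 × V3, f x q' = ∏ i, F i (q' i) := by
      intro q'
      rw [Fin.prod_univ_succ]
      simp only [hF, hf, Fin.cons_zero, Fin.cons_succ]
    simp_rw [hprod]
    rw [lintegral_pi_prod hFm, Fin.prod_univ_succ]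
    simp only [hF, Fin.cons_zero, Fin.cons_succ]
    gcongr
    calc ∏ _a : Fin b, ∫⁻ p, φ x p * g p ≤ ∏ _a : Fin b, Φb := Finset.prod_le_prod' fun a _ => hΦb x
      _ = Φb ^ b := by rw [Finset.prod_const, Finset.card_univ, Fintype.card_fin]
  have hTg : Measurable fun pp : (T3 × V3) × (T3 × V3) => T pp.1 pp.2 * g pp.1 * g pp.2 :=
    (hT.mul (hgm.comp measurable_fst)).mul (hgm.comp measurable_snd)
  calc ENNReal.ofReal (C ^ (b + 2)) * ∫⁻ x, ∫⁻ q' : Fin (b + 1) → T3 × V3, f x q'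
      ≤ ENNReal.ofReal (C ^ (b + 2)) * ∫⁻ x, (∫⁻ p, T x p * g x * g p) * Φb ^ b := by
        gcongr with x
        exact hinner x
    _ = ENNReal.ofReal (C ^ 2) * (ENNReal.ofReal C * Φb) ^ b *
        ∫⁻ pp : (T3 × V3) × (T3 × V3), T pp.1 pp.2 * g pp.1 * g pp.2 := by
        rw [lintegral_mul_const'' _ hTg.lintegral_prod_right'.aemeasurable,
          show (volume : Measure ((T3 × V3) × (T3 × V3))) = (volume : Measure (T3 × V3)).prod volume from rfl,
          lintegral_prod _ hTg.aemeasurable, pow_add, ENNReal.ofReal_mul (pow_nonneg hC _), ENNReal.ofReal_pow hC b,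
          mul_pow]
        ring

/-- **Helper sub-goal `stub_taggedClusterBound`** (line `plaque-thinning-count-ld`, stub 5, tagged half, file 1): the key cluster
bound under a label-set law envelope (`lintegral_pair_mul_prod_le`, closed form). -/
theorem stub_taggedClusterBound : ∀ {N : ℕ} {μ : Measure (Cfg N)} {C β : ℝ}, 0 ≤ C → LabelLawEnvelope μ C β → ∀ {k l : Fin (N + 1)}, k ≠ l → ∀ {A : Finset (Fin (N + 1))}, k ∉ A → l ∉ A → ∀ {T φ : T3 × V3 → T3 × V3 → ℝ≥0∞}, Measurable (fun pp : (T3 × V3) × (T3 × V3) => T pp.1 pp.2) → Measurable (fun pp : (T3 × V3) × (T3 × V3) => φ pp.1 pp.2) → ∀ {Φb : ℝ≥0∞}, (∀ p, ∫⁻ q, φ p q * gaussWeight β q ≤ Φb) → ∫⁻ w, T (w k) (w l) * ∏ j ∈ A, φ (w k) (w j) ∂μ ≤ ENNReal.ofReal (C ^ 2) * (ENNReal.ofReal C * Φb) ^ A.card * ∫⁻ pp : (T3 × V3) × (T3 × V3), T pp.1 pp.2 * gaussWeight β pp.1 * gaussWeight β pp.2 :=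
  fun hC hμ _ _ hkl _ hAk hAl _ _ hT hφ _ hΦb => lintegral_pair_mul_prod_le hC hμ hkl hAk hAl hT hφ hΦb

end Statics

end Summit.AtomisticToContinuum.HydrodynamicLimit.Theorems.CollisionActivityTailsAbnormalActivityTagged

end
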